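import Summits.KontsevichZagierPeriods.KontsevichZagierPeriods.Theses.FurushoPentagon
import Literature.NumberTheory.Transcendental.KZProduct

/-!
# `ReducedPeriodRing` (stmt-KontsevichZagierPeriods-3929), line `Sketch`: proof skeleton v1

Lead prover's skeleton (lead `prover-line-stmt-KontsevichZagierPeriods-3929-a1-0`), owning the
ideator-3 sketch `Cruxes/ReducedPeriodRing/Sketch.lean` (= `Ideator3Sketch.lean`, byte-identical).
That file has NO `stub_*` and no `ReducedPeriodRing_of`; it offers two compositions with the content
in hypotheses:

* Card A (`cartier-at-the-torsor-nilpotents-are-pi-torsion`):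
  `NilIsPiTorsion ∧ KZ.PiCancellation ⇒ ReducedPeriodRing`;
* Card B (`tate-coefficient-regular-effective-monoid`): an injective-mod-relations multiplicative
  move-killing realisation `γ : FormalRep →+ R` into a REDUCED ring `⇒ ReducedPeriodRing`.

Card B is not registrable as a line: its single hypothesis package is EQUIVALENT to the crux
(`Cruxes/ReducedPeriodRing/Triage3Checks.lean: effectiveTransferExists_iff`, kernel-checked), so a
`stub_effectiveTransfer` would be the crux restated. This skeleton therefore registers Card A, the
only non-circular composition of the sketch, with its two inputs as stubs:

* A1 `stub_nilIsPiTorsion` — square-zero classes are `[π]`-power torsion modulo relations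
  (C⁺; ⇔ `IsReduced P[1/[π]]`, `Triage3Checks.localisedTransferExists_iff`); hardest, the lead's.
* A2 `stub_piCancellation` — `KZ.PiCancellation`, verbatim item stmt-KontsevichZagierPeriods-0540 of
  route AyoubSpecialisation (`@[conjecture]`, `[status: open]`).

Composition `ReducedPeriodRing_of` (proved): peel the `N` factors `[π]` off one at a time with A2.
-/

noncomputable section

namespace Summit.KontsevichZagierPeriods.FurushoPentagon.ReducedPeriodRing.SketchLine

open Literature.NumberTheory.Transcendental Literature.NumberTheory.Transcendental.KZ
open Summit.KontsevichZagierPeriods.KontsevichZagierPeriods.Theses.FurushoPentagon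

/-! ## Registered stubs (open) -/

/-- **A1 (C⁺, nilpotents are `[π]`-power torsion; hardest).** If `c * c` is a KZ relation then
`[π]^{*N} * c` is a KZ relation for some `N` (left-nested products, the shape of `KZ.PiLocalKernel`).
[Sketch Card A; Huber–Müller-Stach 2017 §13.2 (torsor) + Cartier, for the MOTIVIC localised algebra] -/
theorem stub_nilIsPiTorsion : ∀ c : FormalRep, c * c ∈ relations →
    ∃ N : ℕ, (fun d => of piRep * d)^[N] c ∈ relations := by
  sorry

/-- **A2 (`π`-cancellation) = item stmt-KontsevichZagierPeriods-0540.** `[π] * c ∈ relations →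
c ∈ relations`. [route AyoubSpecialisation crux 0540; open conjecture] -/
theorem stub_piCancellation : PiCancellation := by
  sorry

/-! ## Composition (proved) -/

/-- **Card A composition**: A1 ∧ A2 ⇒ the crux, by induction on the number `N` of factors `[π]`
(`Function.iterate_succ_apply'` exposes the outermost factor, A2 removes it). [Sketch Card A] -/
theorem ReducedPeriodRing_of : ReducedPeriodRing := by
  intro c hc
  obtain ⟨N, hN⟩ := stub_nilIsPiTorsion c hc
  induction N with
  | zero => simpa using hN
  | succ n ih =>
    apply ih
    rw [Function.iterate_succ_apply'] at hN
    exact stub_piCancellation _ hN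

end Summit.KontsevichZagierPeriods.FurushoPentagon.ReducedPeriodRing.SketchLine
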